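import Literature.Topology.FourManifolds.TrisectionsCentralSurfaceTangent
import Literature.Analysis.Calculus.HadamardLemma
import Mathlib.Analysis.Calculus.InverseFunctionTheorem.ContDiff
import Mathlib.Analysis.Calculus.BumpFunction.InnerProduct
import Mathlib.Analysis.Calculus.Deriv.MeanValue
import HarnessLib

/-!
# The joint linearising chart of a Gay–Kirby trisection at a point of the central surface

Topic `Literature/Topology/FourManifolds`; infrastructure for the fact seat
`provefact-Literature.Topology.FourManifolds.exists-14560f9fc8` (named fact (c′)
`Literature.Topology.FourManifolds.exists_stabilized_gkTrisection`), completing the local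
analysis of `TrisectionsCentralSurfaceLocal.lean` and `TrisectionsCentralSurfaceTangent.lean`.
Everything in this file is **proved**; no definitions, no named facts.

**Theorem (`IsGKTrisection.exists_jointChart`).**  *Let `S` be a trisection with corners of a
smooth `4`-manifold `X` (`Literature.Topology.FourManifolds.IsGKTrisection`), `S i` a sector and
`x` a point of the central surface `F = ⋂ l, S l`.  Then there is a chart `Θ` of the maximal
`C^∞` atlas of `X` at `x`, `Θ x = 0`, in which all three sectors are linear sectors of the
normal `(q₀, q₁)`-plane times `ℝ²`:*
`S i = {q₀ ≥ 0, q₁ ≥ 0}`, `S j = {q₀ ≤ 0, q₀ ≤ q₁}`, `S l = {q₁ ≤ 0, q₁ ≤ q₀}`, `F = {q₀ = q₁ = 0}`.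
This is Gay–Kirby's description of a trisection near the central surface ("`Xᵢ` is locally
`F × (sector)`", Def. 1 and Fig. 1 of Gay–Kirby 2016) *derived from* the corner-chart predicate,
and the starting point of every construction modifying a trisection near `F` (stabilisation,
Def. 8; connected sum).

**Proof.**  `TrisectionsCentralSurfaceTangent.lean` provides linear charts `c = A⁻¹ψ` of
`S i` and `c' = A'⁻¹ψ'` of a neighbour `S j` (`S i = {c ∈ Q}`, `S j = {c' ∈ Q}`, common face
`{q₀ = 0 ≤ q₁}` of both) and the first-order data of the inverse transition `ρ = c' ∘ c⁻¹` at
`0`: for `η = ρ₀`, `ζ = ρ₁` one has `∂₀η < 0`, `∂₁η = 0`, `∂₀ζ < 0 < ∂₁ζ` (the third face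
`S j ∩ S l = {ζ = 0, η ≥ 0}` leaves `F` into the open third quadrant).  The analytic core
`exists_straighten_thirdFace` straightens `{ζ = 0}` while keeping the quadrant: by
**Hadamard's lemma in the two normal coordinates** (`eq_smul_integral_add_smul_integral_of_stratum`,
smoothness by `Literature.Analysis.Calculus.contDiff_intervalIntegral`, applied to `ζ` localised
by a bump) `ζ = q₀ ζ₀ + q₁ ζ₁` with `ζ₀ < 0 < ζ₁` near `0`, and the map
`Φ(q) = (-ζ₀ q₀, ζ₁ q₁, q₂, q₃)` is a local diffeomorphism (inverse function theorem) which
multiplies each normal coordinate by a positive function — so it preserves `Q`, its faces and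
the stratum — and satisfies `Φ₁ - Φ₀ = ζ`, so `{ζ ≥ 0} = {Φ₀ ≤ Φ₁}`.  That `S j = {η ≥ 0, ζ ≥ 0}`
becomes `{Φ₀ ≤ 0, Φ₀ ≤ Φ₁}` uses two elementary estimates: for `q₁ ≥ 0`, `η(0, q₁, ·) = 0`
(the common face) and `∂₀η < 0`, so `η ≥ 0 ⇔ q₀ ≤ 0` (strict monotonicity along `q₀`); for
`q₁ < 0` and `ζ ≥ 0` one has `q₀ ≤ -(ζ₁/|ζ₀|)|q₁|` and then `η = q₀ η₀ + q₁ η₁ > 0` because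
`η₁(0) = ∂₁η(0) = 0`.  Finally `S l` is recovered from the covering clause: it contains the
complement of `S i ∪ S j`, misses their open parts and the open common face, and contains the
closed faces `{q₁ = 0 ≤ q₀}` and `{ζ = 0 ≤ η}`, whence `S l = {Φ₁ ≤ 0, Φ₁ ≤ Φ₀}`.  The chart is
`Θ = Φ ∘ A⁻¹ ∘ ψ`, in the maximal atlas because `Φ ∘ A⁻¹` is in the `C^∞` groupoid.

## Contents

* Hadamard's lemma in the two normal coordinates of `ℝ⁴` (first order, with smooth
  quotients): `eq_smul_integral_add_smul_integral_of_stratum`, `contDiff_hadamard_integral`,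
  `hadamard_integral_of_stratum`; localisation `contDiff_bump_mul`.
* `exists_straighten_thirdFace` — the analytic core (pure analysis on `ℝ⁴`).
* `IsGKTrisection.exists_linearCharts_thirdFace_of_ne` — the first-order package of
  `TrisectionsCentralSurfaceTangent.lean` with the neighbouring sector prescribed.
* `contDiffGroupoid_mem_of_contDiffOn_symm`, `trans_mem_maximalAtlas` — groupoid bookkeeping.
* `IsGKTrisection.exists_jointChart` (the neighbour `S j` across the first face prescribed).

## References

* D. Gay, R. Kirby, *Trisecting 4-manifolds*, Geom. Topol. 20 (2016) 3097–3132
  (arXiv:1205.1565): Def. 1 and Fig. 1 (the sectors near the central surface), Def. 8.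
  [GayKirby2016]
* A. Douady, *Variétés à bord anguleux et voisinages tubulaires*, Séminaire H. Cartan 14
  (1961/62), exp. 1, §1 and §4. [Douady1961]
* M. W. Hirsch, *Differential Topology* (1976), §1.4; Ch. 6 §1 (Hadamard's lemma in the proof
  of Morse's lemma). [Hirsch1976]
* J. Milnor, *Morse theory* (1963), Lemma 2.1 (Hadamard's lemma). [folklore]
-/

open scoped Manifold ContDiff Topology
open Set Function Filter MeasureTheory intervalIntegral

noncomputable section

namespace Literature.Topology.FourManifolds

universe u

/-! ### Hadamard's lemma in the two normal coordinates of `ℝ⁴` -/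

section Hadamard

variable {F : Type*} [NormedAddCommGroup F] [NormedSpace ℝ F]

/-- Scaling the two normal coordinates: `(x₀, x₁, x₂, x₃) ↦ (s x₀, s x₁, x₂, x₃)`, written as
`x - (1 - s) • (x₀ e₀ + x₁ e₁)`; its coordinates. [folklore] -/
theorem normalScale_apply (s : ℝ) (x : EuclideanSpace ℝ (Fin 4)) (k : Fin 4) :
    (x - (1 - s) • ((x 0) • EuclideanSpace.single (0 : Fin 4) (1:ℝ) +
      (x 1) • EuclideanSpace.single (1 : Fin 4) (1:ℝ))) k =
      if k = 0 then s * x 0 else if k = 1 then s * x 1 else x k := by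
  fin_cases k <;> simp <;> ring

/-- The two-coordinate scaling is jointly smooth (polynomial) in `(x, s)`. [folklore] -/
theorem contDiff_normalScale {n : WithTop ℕ∞} :
    ContDiff ℝ n fun p : EuclideanSpace ℝ (Fin 4) × ℝ =>
      p.1 - (1 - p.2) • ((p.1 0) • EuclideanSpace.single (0 : Fin 4) (1:ℝ) +
        (p.1 1) • EuclideanSpace.single (1 : Fin 4) (1:ℝ)) := by
  have h0 : ContDiff ℝ n fun p : EuclideanSpace ℝ (Fin 4) × ℝ => p.1 0 :=
    (contDiff_piLp_apply (p := 2) (n := n) (i := (0 : Fin 4))).comp contDiff_fst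
  have h1 : ContDiff ℝ n fun p : EuclideanSpace ℝ (Fin 4) × ℝ => p.1 1 :=
    (contDiff_piLp_apply (p := 2) (n := n) (i := (1 : Fin 4))).comp contDiff_fst
  exact contDiff_fst.sub ((contDiff_const.sub contDiff_snd).smul
    ((h0.smul contDiff_const).add (h1.smul contDiff_const)))

/-- Derivative of the scaling in `s`: `d/ds (x - (1-s)(x₀e₀ + x₁e₁)) = x₀ e₀ + x₁ e₁`. [folklore] -/
theorem hasDerivAt_normalScale (x : EuclideanSpace ℝ (Fin 4)) (s : ℝ) :
    HasDerivAt (fun s : ℝ => x - (1 - s) • ((x 0) • EuclideanSpace.single (0 : Fin 4) (1:ℝ) +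
      (x 1) • EuclideanSpace.single (1 : Fin 4) (1:ℝ)))
      ((x 0) • EuclideanSpace.single (0 : Fin 4) (1:ℝ) +
        (x 1) • EuclideanSpace.single (1 : Fin 4) (1:ℝ)) s := by
  have h1 : HasDerivAt (fun s : ℝ => (1 - s)) (-1) s := by
    simpa using (hasDerivAt_id s).const_sub 1
  have h2 := (h1.smul_const ((x 0) • EuclideanSpace.single (0 : Fin 4) (1:ℝ) +
      (x 1) • EuclideanSpace.single (1 : Fin 4) (1:ℝ))).const_sub x
  rw [neg_smul, one_smul, neg_neg] at h2
  exact h2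

/-- The integrand of the Hadamard quotients, `(x, s) ↦ Dw(scaled x) e_k`, is `Cⁿ` for
`w ∈ Cⁿ⁺¹`. [folklore] -/
theorem contDiff_hadamard_integrand {w : EuclideanSpace ℝ (Fin 4) → F} {n : ℕ∞}
    (hw : ContDiff ℝ (n + 1) w) (k : Fin 4) :
    ContDiff ℝ n (uncurry fun (x : EuclideanSpace ℝ (Fin 4)) (s : ℝ) =>
      fderiv ℝ w (x - (1 - s) • ((x 0) • EuclideanSpace.single (0 : Fin 4) (1:ℝ) +
        (x 1) • EuclideanSpace.single (1 : Fin 4) (1:ℝ))) (EuclideanSpace.single k 1)) := by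
  have h1 : ContDiff ℝ n fun y => fderiv ℝ w y (EuclideanSpace.single k 1) :=
    (hw.fderiv_right (m := n) le_rfl).clm_apply contDiff_const
  exact h1.comp contDiff_normalScale

/-- **Hadamard's lemma in the two normal coordinates (first order).**  If `w ∈ C¹` vanishes on
the stratum plane `{x₀ = x₁ = 0}` of `ℝ⁴`, then
`w x = x₀ • ∫₀¹ ∂₀w(s x₀, s x₁, x₂, x₃) ds + x₁ • ∫₀¹ ∂₁w(s x₀, s x₁, x₂, x₃) ds`
(fundamental theorem of calculus along the scaling path; Milnor, *Morse theory*, Lemma 2.1).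
[folklore] -/
theorem eq_smul_integral_add_smul_integral_of_stratum [CompleteSpace F]
    {w : EuclideanSpace ℝ (Fin 4) → F} (hw : ContDiff ℝ 1 w)
    (h0 : ∀ x : EuclideanSpace ℝ (Fin 4), x 0 = 0 → x 1 = 0 → w x = 0)
    (x : EuclideanSpace ℝ (Fin 4)) :
    w x = (x 0) • (∫ s in (0:ℝ)..1, fderiv ℝ w (x - (1 - s) •
        ((x 0) • EuclideanSpace.single (0 : Fin 4) (1:ℝ) +
          (x 1) • EuclideanSpace.single (1 : Fin 4) (1:ℝ))) (EuclideanSpace.single 0 1)) +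
      (x 1) • (∫ s in (0:ℝ)..1, fderiv ℝ w (x - (1 - s) •
        ((x 0) • EuclideanSpace.single (0 : Fin 4) (1:ℝ) +
          (x 1) • EuclideanSpace.single (1 : Fin 4) (1:ℝ))) (EuclideanSpace.single 1 1)) := by
  set v : EuclideanSpace ℝ (Fin 4) := (x 0) • EuclideanSpace.single (0 : Fin 4) (1:ℝ) +
    (x 1) • EuclideanSpace.single (1 : Fin 4) (1:ℝ) with hv
  set γ : ℝ → EuclideanSpace ℝ (Fin 4) := fun s => x - (1 - s) • v with hγ
  -- derivative of `s ↦ w (γ s)`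
  have hd : ∀ s, HasDerivAt (fun s => w (γ s))
      ((x 0) • fderiv ℝ w (γ s) (EuclideanSpace.single 0 1) +
        (x 1) • fderiv ℝ w (γ s) (EuclideanSpace.single 1 1)) s := by
    intro s
    have h := ((hw.differentiable one_ne_zero) (γ s)).hasFDerivAt.comp_hasDerivAt s
      (hasDerivAt_normalScale x s)
    simp only [map_add, map_smul] at h
    exact h
  have hc0 := (contDiff_hadamard_integrand (n := 0) (by exact_mod_cast hw) 0).continuous
  have hc1 := (contDiff_hadamard_integrand (n := 0) (by exact_mod_cast hw) 1).continuous
  have hcont : Continuous fun s => (x 0) • fderiv ℝ w (γ s) (EuclideanSpace.single 0 1) +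
      (x 1) • fderiv ℝ w (γ s) (EuclideanSpace.single 1 1) :=
    (continuous_const.smul (hc0.comp (continuous_const.prodMk continuous_id))).add
      (continuous_const.smul (hc1.comp (continuous_const.prodMk continuous_id)))
  have hftc := integral_eq_sub_of_hasDerivAt (fun s _ => hd s) (hcont.intervalIntegrable 0 1)
  have hγ1 : γ 1 = x := by simp [hγ]
  have hγ0 : w (γ 0) = 0 := by
    apply h0
    · simp [hγ, hv]
    · simp [hγ, hv]
  rw [hγ1, hγ0, sub_zero] at hftc
  rw [← hftc, intervalIntegral.integral_add, intervalIntegral.integral_smul,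
    intervalIntegral.integral_smul]
  · exact (continuous_const.smul (hc0.comp (continuous_const.prodMk continuous_id)))
      |>.intervalIntegrable 0 1
  · exact (continuous_const.smul (hc1.comp (continuous_const.prodMk continuous_id)))
      |>.intervalIntegrable 0 1

/-- **Smoothness of the Hadamard quotients**: `w ∈ Cⁿ⁺¹ ⇒ x ↦ ∫₀¹ ∂_k w(scaled x) ds ∈ Cⁿ`
(smooth dependence of parametric integrals,
`Literature.Analysis.Calculus.contDiff_intervalIntegral`). [folklore] -/
theorem contDiff_hadamard_integral [CompleteSpace F] {w : EuclideanSpace ℝ (Fin 4) → F}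
    {n : ℕ∞} (hw : ContDiff ℝ (n + 1) w) (k : Fin 4) :
    ContDiff ℝ n fun x : EuclideanSpace ℝ (Fin 4) => ∫ s in (0:ℝ)..1,
      fderiv ℝ w (x - (1 - s) • ((x 0) • EuclideanSpace.single (0 : Fin 4) (1:ℝ) +
        (x 1) • EuclideanSpace.single (1 : Fin 4) (1:ℝ))) (EuclideanSpace.single k 1) :=
  Literature.Analysis.Calculus.contDiff_intervalIntegral (contDiff_hadamard_integrand hw k) 0 1

/-- **Value of the Hadamard quotients on the stratum**: at a point with `x₀ = x₁ = 0` the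
scaling path is constant, so the quotient is the partial derivative `∂_k w(x)`. [folklore] -/
theorem hadamard_integral_of_stratum [CompleteSpace F] {w : EuclideanSpace ℝ (Fin 4) → F}
    {x : EuclideanSpace ℝ (Fin 4)} (hx0 : x 0 = 0) (hx1 : x 1 = 0) (k : Fin 4) :
    (∫ s in (0:ℝ)..1, fderiv ℝ w (x - (1 - s) •
        ((x 0) • EuclideanSpace.single (0 : Fin 4) (1:ℝ) +
          (x 1) • EuclideanSpace.single (1 : Fin 4) (1:ℝ))) (EuclideanSpace.single k 1)) =
      fderiv ℝ w x (EuclideanSpace.single k 1) := by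
  have : (fun s : ℝ => fderiv ℝ w (x - (1 - s) •
      ((x 0) • EuclideanSpace.single (0 : Fin 4) (1:ℝ) +
        (x 1) • EuclideanSpace.single (1 : Fin 4) (1:ℝ))) (EuclideanSpace.single k 1)) =
      fun _ => fderiv ℝ w x (EuclideanSpace.single k 1) := by
    funext s
    simp [hx0, hx1]
  rw [this, intervalIntegral.integral_const, sub_zero, one_smul]

end Hadamard

/-! ### Localisation of a locally smooth function by a bump -/

section Localise

/-- A function which is `C^∞` on a ball, multiplied by a smooth bump supported in the ball,
is `C^∞` on all of `ℝ⁴`. [folklore] -/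
theorem contDiff_bump_mul {f : EuclideanSpace ℝ (Fin 4) → ℝ} {r : ℝ}
    (hf : ContDiffOn ℝ ∞ f (Metric.ball 0 r)) (χ : ContDiffBump (0 : EuclideanSpace ℝ (Fin 4)))
    (hχ : χ.rOut < r) : ContDiff ℝ ∞ fun q => χ q * f q := by
  rw [contDiff_iff_contDiffAt]
  intro q
  by_cases hq : q ∈ Metric.ball (0 : EuclideanSpace ℝ (Fin 4)) r
  · exact χ.contDiff.contDiffAt.mul (hf.contDiffAt (Metric.isOpen_ball.mem_nhds hq))
  · have hq' : q ∉ tsupport χ := by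
      rw [χ.tsupport_eq]
      intro h
      exact hq (Metric.closedBall_subset_ball hχ h)
    have hev : (χ : EuclideanSpace ℝ (Fin 4) → ℝ) =ᶠ[𝓝 q] 0 :=
      notMem_tsupport_iff_eventuallyEq.mp hq'
    refine (contDiffAt_const (c := (0:ℝ))).congr_of_eventuallyEq ?_
    filter_upwards [hev] with q' hq'
    simp [hq']

end Localise

/-! ### The analytic core: straightening the third face relative to the quadrant -/

section Straighten

/-- Replacing the first coordinate of `q` by `t` with `|t| ≤ |q₀|` does not increase the norm.
[folklore] -/
theorem norm_add_sub_smul_single_le (q : EuclideanSpace ℝ (Fin 4)) {t : ℝ} (ht : |t| ≤ |q 0|) :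
    ‖q + (t - q 0) • EuclideanSpace.single (0 : Fin 4) (1:ℝ)‖ ≤ ‖q‖ := by
  rw [EuclideanSpace.norm_eq, EuclideanSpace.norm_eq]
  refine Real.sqrt_le_sqrt ?_
  simp only [Fin.sum_univ_four, Real.norm_eq_abs, sq_abs]
  have h0 : (q + (t - q 0) • EuclideanSpace.single (0 : Fin 4) (1:ℝ)) 0 = t := by simp
  have h1 : (q + (t - q 0) • EuclideanSpace.single (0 : Fin 4) (1:ℝ)) 1 = q 1 := by simp
  have h2 : (q + (t - q 0) • EuclideanSpace.single (0 : Fin 4) (1:ℝ)) 2 = q 2 := by simp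
  have h3 : (q + (t - q 0) • EuclideanSpace.single (0 : Fin 4) (1:ℝ)) 3 = q 3 := by simp
  rw [h0, h1, h2, h3]
  have : t ^ 2 ≤ q 0 ^ 2 := by
    rw [← sq_abs t, ← sq_abs (q 0)]
    exact pow_le_pow_left₀ (abs_nonneg t) ht 2
  linarith

set_option maxHeartbeats 400000 in -- buildfix (bf3-g26): 160k/180k FAIL, 200k PASS at accept time; line-neutral budget line
/-- **Straightening the third face relative to the quadrant (analytic core of the joint
chart).**  Let `ρ` (the inverse transition `c' ∘ c⁻¹` from the linear chart of `S i` to that of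
`S j`) be `C^∞` on a ball around `0 ∈ ℝ⁴`, map stratum points to stratum points and the closed
face `{q₀ = 0 ≤ q₁}` into `{z₀ = 0}`, with the first-order data of `firstOrder_inverse` at `0`
(`∂₀η < 0`, `∂₁η = 0`, `∂₀ζ < 0 < ∂₁ζ` for `η = ρ₀`, `ζ = ρ₁`).  Then there is a local
diffeomorphism `Φ` of `ℝ⁴` at `0` (`Φ 0 = 0`, `C^∞` with `C^∞` inverse), of the form
`Φ q = (-ζ₀(q) q₀, ζ₁(q) q₁, q₂, q₃)` for a Hadamard decomposition `ζ = q₀ ζ₀ + q₁ ζ₁`, which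
**preserves the sign of each of the two normal coordinates** (so the quadrant `Q`, its two
faces and the stratum are preserved) and in which
**`{ζ ≥ 0} = {Φ₀ ≤ Φ₁}`, `{ζ = 0} = {Φ₀ = Φ₁}` and `{η ≥ 0, ζ ≥ 0} = {Φ₀ ≤ 0, Φ₀ ≤ Φ₁}`**
(with the strict versions): the picture of `S j` becomes the linear sector between the ray
`{Φ₀ = 0 ≤ Φ₁}` and the diagonal ray `{Φ₀ = Φ₁ ≤ 0}`, while `S i` stays the quadrant.
(Monotonicity of `η` in `q₀` where `q₁ ≥ 0`, and the estimate `η > 0` on `{ζ ≥ 0, q₁ < 0}` from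
`∂₁η(0) = 0`.) [cite: GayKirby2016, Def. 1 and Fig. 1] [cite: Hirsch1976, §1.4] -/
theorem exists_straighten_thirdFace {ρ : EuclideanSpace ℝ (Fin 4) → EuclideanSpace ℝ (Fin 4)}
    {r : ℝ} (hr : 0 < r) (hρ : ContDiffOn ℝ ∞ ρ (Metric.ball 0 r))
    (hstr : ∀ q ∈ Metric.ball (0 : EuclideanSpace ℝ (Fin 4)) r,
      q 0 = 0 → q 1 = 0 → ρ q 0 = 0 ∧ ρ q 1 = 0)
    (hface : ∀ q ∈ Metric.ball (0 : EuclideanSpace ℝ (Fin 4)) r, q 0 = 0 → 0 ≤ q 1 → ρ q 0 = 0)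
    (hM00 : fderiv ℝ ρ 0 (EuclideanSpace.single 0 1) 0 < 0)
    (hM10 : fderiv ℝ ρ 0 (EuclideanSpace.single 1 1) 0 = 0)
    (hM01 : fderiv ℝ ρ 0 (EuclideanSpace.single 0 1) 1 < 0)
    (hM11 : 0 < fderiv ℝ ρ 0 (EuclideanSpace.single 1 1) 1) :
    ∃ Φ : OpenPartialHomeomorph (EuclideanSpace ℝ (Fin 4)) (EuclideanSpace ℝ (Fin 4)),
      0 ∈ Φ.source ∧ Φ 0 = 0 ∧ Φ.source ⊆ Metric.ball 0 r ∧
      ContDiffOn ℝ ∞ Φ Φ.source ∧ ContDiffOn ℝ ∞ Φ.symm Φ.target ∧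
      (∀ q ∈ Φ.source, Φ q 2 = q 2 ∧ Φ q 3 = q 3) ∧
      (∀ q ∈ Φ.source, (0 ≤ q 0 ↔ 0 ≤ Φ q 0) ∧ (0 < q 0 ↔ 0 < Φ q 0) ∧
        (0 ≤ q 1 ↔ 0 ≤ Φ q 1) ∧ (0 < q 1 ↔ 0 < Φ q 1)) ∧
      (∀ q ∈ Φ.source, (0 ≤ ρ q 1 ↔ Φ q 0 ≤ Φ q 1) ∧ (0 < ρ q 1 ↔ Φ q 0 < Φ q 1)) ∧
      (∀ q ∈ Φ.source, (0 ≤ ρ q 0 ∧ 0 ≤ ρ q 1) ↔ (Φ q 0 ≤ 0 ∧ Φ q 0 ≤ Φ q 1)) ∧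
      (∀ q ∈ Φ.source, (0 < ρ q 0 ∧ 0 < ρ q 1) ↔ (Φ q 0 < 0 ∧ Φ q 0 < Φ q 1)) := by
  -- notation for the basis vectors
  set e0 : EuclideanSpace ℝ (Fin 4) := EuclideanSpace.single 0 1 with he0
  set e1 : EuclideanSpace ℝ (Fin 4) := EuclideanSpace.single 1 1 with he1
  set e2 : EuclideanSpace ℝ (Fin 4) := EuclideanSpace.single 2 1 with he2
  set e3 : EuclideanSpace ℝ (Fin 4) := EuclideanSpace.single 3 1 with he3
  have hball0 : (0 : EuclideanSpace ℝ (Fin 4)) ∈ Metric.ball (0 : EuclideanSpace ℝ (Fin 4)) r :=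
    Metric.mem_ball_self hr
  have hρ0 : ρ 0 0 = 0 ∧ ρ 0 1 = 0 := hstr 0 hball0 rfl rfl
  have hρdiff : DifferentiableAt ℝ ρ 0 :=
    (hρ.contDiffAt (Metric.isOpen_ball.mem_nhds hball0)).differentiableAt (by simp)
  -- ### localisation
  let χ : ContDiffBump (0 : EuclideanSpace ℝ (Fin 4)) := ⟨r / 4, r / 2, by positivity, by linarith⟩
  have hχr : χ.rOut < r := by show r / 2 < r; linarith
  have hχ1 : ∀ q ∈ Metric.ball (0 : EuclideanSpace ℝ (Fin 4)) (r / 4), χ q = 1 := fun q hq =>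
    χ.one_of_mem_closedBall (Metric.ball_subset_closedBall hq)
  have hsub4 : Metric.ball (0 : EuclideanSpace ℝ (Fin 4)) (r / 4) ⊆ Metric.ball 0 r :=
    Metric.ball_subset_ball (by linarith)
  set ζg : EuclideanSpace ℝ (Fin 4) → ℝ := fun q => χ q * ρ q 1 with hζg
  set ηg : EuclideanSpace ℝ (Fin 4) → ℝ := fun q => χ q * ρ q 0 with hηg
  have hρ1 : ContDiffOn ℝ ∞ (fun q => ρ q 1) (Metric.ball 0 r) :=
    ((EuclideanSpace.proj (1 : Fin 4) : EuclideanSpace ℝ (Fin 4) →L[ℝ] ℝ).contDiff.comp_contDiffOn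
      hρ).congr fun q _ => rfl
  have hρ0' : ContDiffOn ℝ ∞ (fun q => ρ q 0) (Metric.ball 0 r) :=
    ((EuclideanSpace.proj (0 : Fin 4) : EuclideanSpace ℝ (Fin 4) →L[ℝ] ℝ).contDiff.comp_contDiffOn
      hρ).congr fun q _ => rfl
  have hζs : ContDiff ℝ ∞ ζg := contDiff_bump_mul hρ1 χ hχr
  have hηs : ContDiff ℝ ∞ ηg := contDiff_bump_mul hρ0' χ hχr
  have hζeq : ∀ q ∈ Metric.ball (0 : EuclideanSpace ℝ (Fin 4)) (r / 4), ζg q = ρ q 1 :=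
    fun q hq => by simp [hζg, hχ1 q hq]
  have hηeq : ∀ q ∈ Metric.ball (0 : EuclideanSpace ℝ (Fin 4)) (r / 4), ηg q = ρ q 0 :=
    fun q hq => by simp [hηg, hχ1 q hq]
  -- vanishing on the stratum plane, globally
  have hvan : ∀ (f : EuclideanSpace ℝ (Fin 4) → ℝ) (k : Fin 4), (k = 0 ∨ k = 1) →
      (f = fun q => χ q * ρ q k) → ∀ q : EuclideanSpace ℝ (Fin 4), q 0 = 0 → q 1 = 0 → f q = 0 := by
    rintro f k hk rfl q hq0 hq1
    by_cases hq : q ∈ Metric.ball (0 : EuclideanSpace ℝ (Fin 4)) r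
    · obtain ⟨h0, h1⟩ := hstr q hq hq0 hq1
      rcases hk with rfl | rfl
      · simp [h0]
      · simp [h1]
    · have : χ q = 0 := by
        apply χ.zero_of_le_dist
        rw [Metric.mem_ball] at hq
        push Not at hq
        show r / 2 ≤ dist q 0
        linarith
      simp [this]
  have hζvan := hvan ζg 1 (Or.inr rfl) rfl
  have hηvan := hvan ηg 0 (Or.inl rfl) rfl
  -- ### Hadamard decompositions
  have htop : ((⊤ : ℕ∞) + 1 : ℕ∞) = ⊤ := rfl
  have hζs' : ContDiff ℝ ((⊤ : ℕ∞) + 1 : ℕ∞) ζg := by rw [htop]; exact hζs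
  have hηs' : ContDiff ℝ ((⊤ : ℕ∞) + 1 : ℕ∞) ηg := by rw [htop]; exact hηs
  set Z0 : EuclideanSpace ℝ (Fin 4) → ℝ := fun x => ∫ s in (0:ℝ)..1, fderiv ℝ ζg (x - (1 - s) •
      ((x 0) • EuclideanSpace.single (0 : Fin 4) (1:ℝ) +
        (x 1) • EuclideanSpace.single (1 : Fin 4) (1:ℝ))) (EuclideanSpace.single 0 1) with hZ0
  set Z1 : EuclideanSpace ℝ (Fin 4) → ℝ := fun x => ∫ s in (0:ℝ)..1, fderiv ℝ ζg (x - (1 - s) •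
      ((x 0) • EuclideanSpace.single (0 : Fin 4) (1:ℝ) +
        (x 1) • EuclideanSpace.single (1 : Fin 4) (1:ℝ))) (EuclideanSpace.single 1 1) with hZ1
  set H0 : EuclideanSpace ℝ (Fin 4) → ℝ := fun x => ∫ s in (0:ℝ)..1, fderiv ℝ ηg (x - (1 - s) •
      ((x 0) • EuclideanSpace.single (0 : Fin 4) (1:ℝ) +
        (x 1) • EuclideanSpace.single (1 : Fin 4) (1:ℝ))) (EuclideanSpace.single 0 1) with hH0
  set H1 : EuclideanSpace ℝ (Fin 4) → ℝ := fun x => ∫ s in (0:ℝ)..1, fderiv ℝ ηg (x - (1 - s) •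
      ((x 0) • EuclideanSpace.single (0 : Fin 4) (1:ℝ) +
        (x 1) • EuclideanSpace.single (1 : Fin 4) (1:ℝ))) (EuclideanSpace.single 1 1) with hH1
  have hZ0s : ContDiff ℝ ∞ Z0 := contDiff_hadamard_integral (n := ⊤) hζs' 0
  have hZ1s : ContDiff ℝ ∞ Z1 := contDiff_hadamard_integral (n := ⊤) hζs' 1
  have hH0s : ContDiff ℝ ∞ H0 := contDiff_hadamard_integral (n := ⊤) hηs' 0
  have hH1s : ContDiff ℝ ∞ H1 := contDiff_hadamard_integral (n := ⊤) hηs' 1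
  have hζdec : ∀ q, ζg q = q 0 * Z0 q + q 1 * Z1 q := fun q => by
    have := eq_smul_integral_add_smul_integral_of_stratum (F := ℝ)
      (hζs.of_le (by simp)) hζvan q
    simpa only [smul_eq_mul] using this
  have hηdec : ∀ q, ηg q = q 0 * H0 q + q 1 * H1 q := fun q => by
    have := eq_smul_integral_add_smul_integral_of_stratum (F := ℝ)
      (hηs.of_le (by simp)) hηvan q
    simpa only [smul_eq_mul] using this
  -- ### values at `0`
  have hnhds4 : Metric.ball (0 : EuclideanSpace ℝ (Fin 4)) (r / 4) ∈
      𝓝 (0 : EuclideanSpace ℝ (Fin 4)) :=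
    Metric.isOpen_ball.mem_nhds (Metric.mem_ball_self (by positivity))
  have hfdζ : ∀ v, fderiv ℝ ζg 0 v = fderiv ℝ ρ 0 v 1 := by
    intro v
    have h1 : ζg =ᶠ[𝓝 0] fun q => ρ q 1 := by
      filter_upwards [hnhds4] with q hq using hζeq q hq
    rw [h1.fderiv_eq]
    have h2 : HasFDerivAt (fun q => ρ q 1)
        ((EuclideanSpace.proj (1 : Fin 4) : EuclideanSpace ℝ (Fin 4) →L[ℝ] ℝ).comp
          (fderiv ℝ ρ 0)) 0 :=
      ((EuclideanSpace.proj (1 : Fin 4) : EuclideanSpace ℝ (Fin 4) →L[ℝ] ℝ).hasFDerivAt.comp 0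
        hρdiff.hasFDerivAt).congr_of_eventuallyEq (Eventually.of_forall fun q => rfl)
    rw [h2.fderiv]
    rfl
  have hfdη : ∀ v, fderiv ℝ ηg 0 v = fderiv ℝ ρ 0 v 0 := by
    intro v
    have h1 : ηg =ᶠ[𝓝 0] fun q => ρ q 0 := by
      filter_upwards [hnhds4] with q hq using hηeq q hq
    rw [h1.fderiv_eq]
    have h2 : HasFDerivAt (fun q => ρ q 0)
        ((EuclideanSpace.proj (0 : Fin 4) : EuclideanSpace ℝ (Fin 4) →L[ℝ] ℝ).comp
          (fderiv ℝ ρ 0)) 0 :=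
      ((EuclideanSpace.proj (0 : Fin 4) : EuclideanSpace ℝ (Fin 4) →L[ℝ] ℝ).hasFDerivAt.comp 0
        hρdiff.hasFDerivAt).congr_of_eventuallyEq (Eventually.of_forall fun q => rfl)
    rw [h2.fderiv]
    rfl
  have hZ00 : Z0 0 = fderiv ℝ ρ 0 (EuclideanSpace.single 0 1) 1 := by
    rw [hZ0]
    simp only
    rw [hadamard_integral_of_stratum (F := ℝ) (w := ζg) rfl rfl 0, hfdζ]
  have hZ10 : Z1 0 = fderiv ℝ ρ 0 (EuclideanSpace.single 1 1) 1 := by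
    rw [hZ1]
    simp only
    rw [hadamard_integral_of_stratum (F := ℝ) (w := ζg) rfl rfl 1, hfdζ]
  have hH00 : H0 0 = fderiv ℝ ρ 0 (EuclideanSpace.single 0 1) 0 := by
    rw [hH0]
    simp only
    rw [hadamard_integral_of_stratum (F := ℝ) (w := ηg) rfl rfl 0, hfdη]
  have hH10 : H1 0 = 0 := by
    rw [hH1]
    simp only
    rw [hadamard_integral_of_stratum (F := ℝ) (w := ηg) rfl rfl 1, hfdη, hM10]
  -- ### the straightening map `Θ`
  set Θ : EuclideanSpace ℝ (Fin 4) → EuclideanSpace ℝ (Fin 4) := fun q =>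
    (-(Z0 q * q 0)) • e0 + (Z1 q * q 1) • e1 + (q 2) • e2 + (q 3) • e3 with hΘ
  have hc0 : ContDiff ℝ ∞ fun q : EuclideanSpace ℝ (Fin 4) => q 0 :=
    contDiff_piLp_apply (p := 2) (i := (0 : Fin 4))
  have hc1 : ContDiff ℝ ∞ fun q : EuclideanSpace ℝ (Fin 4) => q 1 :=
    contDiff_piLp_apply (p := 2) (i := (1 : Fin 4))
  have hc2 : ContDiff ℝ ∞ fun q : EuclideanSpace ℝ (Fin 4) => q 2 :=
    contDiff_piLp_apply (p := 2) (i := (2 : Fin 4))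
  have hc3 : ContDiff ℝ ∞ fun q : EuclideanSpace ℝ (Fin 4) => q 3 :=
    contDiff_piLp_apply (p := 2) (i := (3 : Fin 4))
  have hΘs : ContDiff ℝ ∞ Θ :=
    ((((hZ0s.mul hc0).neg.smul contDiff_const).add ((hZ1s.mul hc1).smul contDiff_const)).add
      (hc2.smul contDiff_const)).add (hc3.smul contDiff_const)
  have hΘ0 : ∀ q, Θ q 0 = -(Z0 q * q 0) := fun q => by simp [hΘ, he0, he1, he2, he3]
  have hΘ1 : ∀ q, Θ q 1 = Z1 q * q 1 := fun q => by simp [hΘ, he0, he1, he2, he3]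
  have hΘ2 : ∀ q, Θ q 2 = q 2 := fun q => by simp [hΘ, he0, he1, he2, he3]
  have hΘ3 : ∀ q, Θ q 3 = q 3 := fun q => by simp [hΘ, he0, he1, he2, he3]
  have hΘzero : Θ 0 = 0 := by
    ext k; fin_cases k <;> simp [hΘ0, hΘ1, hΘ2, hΘ3]
  -- its derivative at `0`
  set D : EuclideanSpace ℝ (Fin 4) →L[ℝ] EuclideanSpace ℝ (Fin 4) :=
    (-((Z0 0) •
      (EuclideanSpace.proj (0 : Fin 4) : EuclideanSpace ℝ (Fin 4) →L[ℝ] ℝ))).smulRight e0 +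
    ((Z1 0) • (EuclideanSpace.proj (1 : Fin 4) : EuclideanSpace ℝ (Fin 4) →L[ℝ] ℝ)).smulRight e1 +
    (EuclideanSpace.proj (2 : Fin 4) : EuclideanSpace ℝ (Fin 4) →L[ℝ] ℝ).smulRight e2 +
    (EuclideanSpace.proj (3 : Fin 4) : EuclideanSpace ℝ (Fin 4) →L[ℝ] ℝ).smulRight e3 with hD
  have hDapply : ∀ v : EuclideanSpace ℝ (Fin 4),
      D v = (-(Z0 0 * v 0)) • e0 + (Z1 0 * v 1) • e1 + (v 2) • e2 + (v 3) • e3 := by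
    intro v
    simp only [hD]
    rfl
  have hD0 : ∀ v, D v 0 = -(Z0 0 * v 0) := fun v => by rw [hDapply]; simp [he0, he1, he2, he3]
  have hD1 : ∀ v, D v 1 = Z1 0 * v 1 := fun v => by rw [hDapply]; simp [he0, he1, he2, he3]
  have hD2 : ∀ v, D v 2 = v 2 := fun v => by rw [hDapply]; simp [he0, he1, he2, he3]
  have hD3 : ∀ v, D v 3 = v 3 := fun v => by rw [hDapply]; simp [he0, he1, he2, he3]
  have hproj : ∀ k : Fin 4, HasFDerivAt (fun q : EuclideanSpace ℝ (Fin 4) => q k)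
      (EuclideanSpace.proj k : EuclideanSpace ℝ (Fin 4) →L[ℝ] ℝ) 0 := fun k =>
    ((EuclideanSpace.proj k : EuclideanSpace ℝ (Fin 4) →L[ℝ] ℝ).hasFDerivAt).congr_of_eventuallyEq
      (Eventually.of_forall fun q => rfl)
  have hzero0 : ((0 : EuclideanSpace ℝ (Fin 4)) 0) = 0 := rfl
  have hzero1 : ((0 : EuclideanSpace ℝ (Fin 4)) 1) = 0 := rfl
  have hΘd : HasFDerivAt Θ D 0 := by
    have h0 : HasFDerivAt (fun q => -(Z0 q * q 0))
        (-((Z0 0) • (EuclideanSpace.proj (0 : Fin 4) : EuclideanSpace ℝ (Fin 4) →L[ℝ] ℝ))) 0 := by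
      have hm := (hZ0s.differentiable (by simp) 0).hasFDerivAt.mul (hproj 0)
      rw [hzero0, zero_smul, add_zero] at hm
      exact hm.neg
    have h1 : HasFDerivAt (fun q => Z1 q * q 1)
        ((Z1 0) • (EuclideanSpace.proj (1 : Fin 4) : EuclideanSpace ℝ (Fin 4) →L[ℝ] ℝ)) 0 := by
      have hm := (hZ1s.differentiable (by simp) 0).hasFDerivAt.mul (hproj 1)
      rw [hzero1, zero_smul, add_zero] at hm
      exact hm
    exact (((h0.smul_const e0).add (h1.smul_const e1)).add ((hproj 2).smul_const e2)).add
      ((hproj 3).smul_const e3)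
  have hDinj : Injective D := by
    intro v w hvw
    have hZ0ne : Z0 0 ≠ 0 := by rw [hZ00]; exact hM01.ne
    have hZ1ne : Z1 0 ≠ 0 := by rw [hZ10]; exact hM11.ne'
    have hk0 : v 0 = w 0 := by
      have := congrArg (fun u : EuclideanSpace ℝ (Fin 4) => u 0) hvw
      simp only [hD0, neg_inj] at this
      exact mul_left_cancel₀ hZ0ne this
    have hk1 : v 1 = w 1 := by
      have := congrArg (fun u : EuclideanSpace ℝ (Fin 4) => u 1) hvw
      simp only [hD1] at this
      exact mul_left_cancel₀ hZ1ne this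
    have hk2 : v 2 = w 2 := by
      have := congrArg (fun u : EuclideanSpace ℝ (Fin 4) => u 2) hvw
      simp only [hD2] at this
      exact this
    have hk3 : v 3 = w 3 := by
      have := congrArg (fun u : EuclideanSpace ℝ (Fin 4) => u 3) hvw
      simp only [hD3] at this
      exact this
    ext k
    fin_cases k
    exacts [hk0, hk1, hk2, hk3]
  set E : EuclideanSpace ℝ (Fin 4) ≃L[ℝ] EuclideanSpace ℝ (Fin 4) :=
    LinearEquiv.toContinuousLinearEquiv (LinearEquiv.ofInjectiveEndo D.toLinearMap hDinj) with hE
  have hEcoe : (E : EuclideanSpace ℝ (Fin 4) →L[ℝ] EuclideanSpace ℝ (Fin 4)) = D := by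
    ext v k
    rfl
  have hΘdE : HasFDerivAt Θ (E : EuclideanSpace ℝ (Fin 4) →L[ℝ] EuclideanSpace ℝ (Fin 4)) 0 := by
    rw [hEcoe]; exact hΘd
  -- ### the inverse function theorem
  have hΘat : ContDiffAt ℝ ∞ Θ 0 := hΘs.contDiffAt
  set Φ₀ := hΘat.toOpenPartialHomeomorph Θ hΘdE (by simp) with hΦ₀
  have hΦ₀src : (0 : EuclideanSpace ℝ (Fin 4)) ∈ Φ₀.source :=
    hΘat.mem_toOpenPartialHomeomorph_source hΘdE (by simp)
  have hΦ₀coe : (Φ₀ : EuclideanSpace ℝ (Fin 4) → EuclideanSpace ℝ (Fin 4)) = Θ := rfl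
  -- invertibility of the derivative near `0`
  set U₁ : Set (EuclideanSpace ℝ (Fin 4)) := {q | fderiv ℝ Θ q ∈ range ((↑) :
    (EuclideanSpace ℝ (Fin 4) ≃L[ℝ] EuclideanSpace ℝ (Fin 4)) →
      EuclideanSpace ℝ (Fin 4) →L[ℝ] EuclideanSpace ℝ (Fin 4))} with hU₁
  have hU₁open : IsOpen U₁ :=
    (ContinuousLinearEquiv.isOpen).preimage (hΘs.continuous_fderiv (by simp))
  have hU₁0 : (0 : EuclideanSpace ℝ (Fin 4)) ∈ U₁ := ⟨E, hΘdE.fderiv.symm⟩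
  -- ### the neighbourhood where all sign conditions hold
  set dη0 : EuclideanSpace ℝ (Fin 4) → ℝ := fun q => fderiv ℝ ηg q e0 with hdη0
  have hdη0c : Continuous dη0 :=
    (hηs.continuous_fderiv (by simp)).clm_apply continuous_const
  have hdη00 : dη0 0 < 0 := by
    show fderiv ℝ ηg 0 e0 < 0
    rw [hfdη, he0]; exact hM00
  set W₁ : Set (EuclideanSpace ℝ (Fin 4)) := {q | Z0 q < 0 ∧ 0 < Z1 q ∧ H0 q < 0 ∧
    |H1 q| * (-(Z0 q)) < Z1 q * (-(H0 q)) ∧ dη0 q < 0} with hW₁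
  have hW₁open : IsOpen W₁ :=
    (isOpen_lt hZ0s.continuous continuous_const).inter
      ((isOpen_lt continuous_const hZ1s.continuous).inter
      ((isOpen_lt hH0s.continuous continuous_const).inter
      ((isOpen_lt (hH1s.continuous.abs.mul hZ0s.continuous.neg)
        (hZ1s.continuous.mul hH0s.continuous.neg)).inter
      (isOpen_lt hdη0c continuous_const))))
  have hW₁0 : (0 : EuclideanSpace ℝ (Fin 4)) ∈ W₁ := by
    refine ⟨by rw [hZ00]; exact hM01, by rw [hZ10]; exact hM11, by rw [hH00]; exact hM00, ?_, hdη00⟩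
    rw [hH10, abs_zero, zero_mul, hZ10, hH00]
    exact mul_pos hM11 (neg_pos.mpr hM00)
  -- a ball inside everything
  obtain ⟨r₂, hr₂, hball₂⟩ : ∃ r₂ > 0, Metric.ball (0 : EuclideanSpace ℝ (Fin 4)) r₂ ⊆
      Φ₀.source ∩ U₁ ∩ W₁ ∩ Metric.ball 0 (r / 4) := by
    have hopen : IsOpen (Φ₀.source ∩ U₁ ∩ W₁ ∩ Metric.ball 0 (r / 4)) :=
      ((Φ₀.open_source.inter hU₁open).inter hW₁open).inter Metric.isOpen_ball
    exact Metric.isOpen_iff.mp hopen 0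
      ⟨⟨⟨hΦ₀src, hU₁0⟩, hW₁0⟩, Metric.mem_ball_self (by positivity)⟩
  set Φ := Φ₀.restrOpen (Metric.ball 0 r₂) Metric.isOpen_ball with hΦdef
  have hΦcoe : (Φ : EuclideanSpace ℝ (Fin 4) → EuclideanSpace ℝ (Fin 4)) = Θ := rfl
  have hΦsrc : Φ.source = Metric.ball 0 r₂ := by
    rw [hΦdef, OpenPartialHomeomorph.restrOpen_source]
    exact inter_eq_right.mpr fun q hq => (hball₂ hq).1.1.1
  have hsrcW : ∀ q ∈ Φ.source, q ∈ W₁ := fun q hq => (hball₂ (hΦsrc ▸ hq)).1.2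
  have hsrcU : ∀ q ∈ Φ.source, q ∈ U₁ := fun q hq => (hball₂ (hΦsrc ▸ hq)).1.1.2
  have hsrc4 : ∀ q ∈ Φ.source, q ∈ Metric.ball (0 : EuclideanSpace ℝ (Fin 4)) (r / 4) :=
    fun q hq => (hball₂ (hΦsrc ▸ hq)).2
  have hsrc0 : (0 : EuclideanSpace ℝ (Fin 4)) ∈ Φ.source := by
    rw [hΦsrc]; exact Metric.mem_ball_self hr₂
  -- ### smoothness of `Φ` and of its inverse
  have hΦsmooth : ContDiffOn ℝ ∞ Φ Φ.source := by rw [hΦcoe]; exact hΘs.contDiffOn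
  have hΦsymm : ContDiffOn ℝ ∞ Φ.symm Φ.target := by
    intro a ha
    have hq : Φ.symm a ∈ Φ.source := Φ.map_target ha
    obtain ⟨Eq, hEq⟩ := hsrcU _ hq
    have hd : HasFDerivAt Φ (Eq : EuclideanSpace ℝ (Fin 4) →L[ℝ] EuclideanSpace ℝ (Fin 4))
        (Φ.symm a) := by
      rw [hEq, hΦcoe]
      exact (hΘs.differentiable (by simp) _).hasFDerivAt
    exact (Φ.contDiffAt_symm ha hd (by rw [hΦcoe]; exact hΘs.contDiffAt)).contDiffWithinAt
  -- ### the sign conditions on the source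
  have hpos : ∀ q ∈ Φ.source, 0 < -(Z0 q) ∧ 0 < Z1 q := fun q hq =>
    ⟨neg_pos.mpr (hsrcW q hq).1, (hsrcW q hq).2.1⟩
  have hΦ0 : ∀ q, Φ q 0 = (-(Z0 q)) * q 0 := fun q => by rw [hΦcoe, hΘ0]; ring
  have hΦ1 : ∀ q, Φ q 1 = Z1 q * q 1 := fun q => by rw [hΦcoe, hΘ1]
  -- `ζ` in the new coordinates
  have hζΦ : ∀ q ∈ Φ.source, ρ q 1 = Φ q 1 - Φ q 0 := fun q hq => by
    rw [← hζeq q (hsrc4 q hq), hζdec q, hΦ0, hΦ1]; ring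
  -- `η`: monotonicity in `q₀` where `q₁ ≥ 0`
  have hηmono : ∀ q ∈ Φ.source, 0 ≤ q 1 →
      (0 ≤ ρ q 0 ↔ q 0 ≤ 0) ∧ (0 < ρ q 0 ↔ q 0 < 0) := by
    intro q hq hq1
    have hqball : ‖q‖ < r₂ := by rw [hΦsrc] at hq; exact mem_ball_zero_iff.mp hq
    set pth : ℝ → EuclideanSpace ℝ (Fin 4) := fun t => q + (t - q 0) • e0 with hpth
    have hpth0 : ∀ t, pth t 0 = t := fun t => by simp [hpth, he0]
    have hpth1 : ∀ t, pth t 1 = q 1 := fun t => by simp [hpth, he0]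
    have hpthq : pth (q 0) = q := by simp [hpth]
    have hpth_src : ∀ t ∈ Icc (-|q 0|) |q 0|, pth t ∈ Φ.source := by
      intro t ht
      rw [hΦsrc, mem_ball_zero_iff]
      exact lt_of_le_of_lt (norm_add_sub_smul_single_le q (abs_le.mpr ⟨ht.1, ht.2⟩)) hqball
    set g : ℝ → ℝ := fun t => ηg (pth t) with hg
    have hg_deriv : ∀ t, HasDerivAt g (dη0 (pth t)) t := by
      intro t
      have hp : HasDerivAt pth e0 t := by
        have := (((hasDerivAt_id t).sub_const (q 0)).smul_const e0).const_add q
        simp only [one_smul] at this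
        exact this
      exact (hηs.differentiable (by simp) (pth t)).hasFDerivAt.comp_hasDerivAt t hp
    have hg_cont : Continuous g := hηs.continuous.comp (by fun_prop)
    have hg_anti : StrictAntiOn g (Icc (-|q 0|) |q 0|) :=
      strictAntiOn_of_deriv_neg (convex_Icc _ _) hg_cont.continuousOn fun t ht => by
        rw [(hg_deriv t).deriv]
        exact (hsrcW _ (hpth_src t (interior_subset ht))).2.2.2.2
    have hgq : g (q 0) = ρ q 0 := by
      show ηg (pth (q 0)) = ρ q 0
      rw [hpthq, hηeq q (hsrc4 q hq)]
    have hg0 : g 0 = 0 := by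
      show ηg (pth 0) = 0
      have hmem : pth 0 ∈ Φ.source := hpth_src 0 ⟨by simp, by simp⟩
      rw [hηeq _ (hsrc4 _ hmem)]
      exact hface _ (hsub4 (hsrc4 _ hmem)) (hpth0 0) (by rw [hpth1]; exact hq1)
    have h0mem : (0:ℝ) ∈ Icc (-|q 0|) |q 0| := ⟨by simp, by simp⟩
    have hqmem : q 0 ∈ Icc (-|q 0|) |q 0| := ⟨neg_abs_le _, le_abs_self _⟩
    constructor
    · have := hg_anti.le_iff_ge h0mem hqmem
      rw [hg0, hgq] at this
      exact this
    · have := hg_anti.lt_iff_gt h0mem hqmem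
      rw [hg0, hgq] at this
      exact this
  -- `η`: the estimate where `q₁ < 0` and `ζ ≥ 0`
  have hηest : ∀ q ∈ Φ.source, q 1 < 0 → 0 ≤ ρ q 1 → q 0 < 0 ∧ 0 < ρ q 0 := by
    intro q hq hq1 hζ
    obtain ⟨hZ0, hZ1, hH0, hcmp, -⟩ := hsrcW q hq
    have hζ' : 0 ≤ q 0 * Z0 q + q 1 * Z1 q := by
      rw [← hζdec q, hζeq q (hsrc4 q hq)]; exact hζ
    set a := -(Z0 q) with ha
    set b := Z1 q with hb
    set c := -(H0 q) with hc
    have hapos : 0 < a := neg_pos.mpr hZ0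
    have hcpos : 0 < c := neg_pos.mpr hH0
    have h1 : a * q 0 ≤ b * q 1 := by
      have : Z0 q = -a := by rw [ha, neg_neg]
      rw [this] at hζ'
      linarith
    have hq0 : q 0 < 0 := by
      by_contra h
      push Not at h
      have : b * q 1 < 0 := mul_neg_of_pos_of_neg hZ1 hq1
      have : 0 ≤ a * q 0 := mul_nonneg hapos.le h
      linarith
    refine ⟨hq0, ?_⟩
    rw [← hηeq q (hsrc4 q hq), hηdec q]
    have h4 : c * (a * q 0) ≤ c * (b * q 1) := mul_le_mul_of_nonneg_left h1 hcpos.le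
    have h5 : (b * c) * q 1 < (|H1 q| * a) * q 1 := mul_lt_mul_of_neg_right hcmp hq1
    have h6 : a * (c * q 0) < a * (|H1 q| * q 1) := by
      have e1 : c * (a * q 0) = a * (c * q 0) := by ring
      have e2 : c * (b * q 1) = (b * c) * q 1 := by ring
      have e3 : (|H1 q| * a) * q 1 = a * (|H1 q| * q 1) := by ring
      rw [e1, e2] at h4
      rw [e3] at h5
      exact lt_of_le_of_lt h4 h5
    have h7 : c * q 0 < |H1 q| * q 1 := lt_of_mul_lt_mul_left h6 hapos.le
    have h8 : q 1 * |H1 q| ≤ q 1 * H1 q :=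
      mul_le_mul_of_nonpos_left (le_abs_self _) hq1.le
    have hH0' : H0 q = -c := by rw [hc, neg_neg]
    rw [hH0']
    nlinarith [h7, h8]
  -- ### assembling
  refine ⟨Φ, hsrc0, by rw [hΦcoe, hΘzero], fun q hq => hsub4 (hsrc4 q hq), hΦsmooth, hΦsymm,
    fun q _ => ⟨by rw [hΦcoe, hΘ2], by rw [hΦcoe, hΘ3]⟩, fun q hq => ?_, fun q hq => ?_,
    fun q hq => ?_, fun q hq => ?_⟩
  · -- signs of the two normal coordinates
    obtain ⟨ha, hb⟩ := hpos q hq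
    rw [hΦ0, hΦ1]
    exact ⟨(mul_nonneg_iff_of_pos_left ha).symm, (mul_pos_iff_of_pos_left ha).symm,
      (mul_nonneg_iff_of_pos_left hb).symm, (mul_pos_iff_of_pos_left hb).symm⟩
  · -- `ζ`
    rw [hζΦ q hq]
    exact ⟨sub_nonneg, sub_pos⟩
  · -- `S j`
    obtain ⟨ha, -⟩ := hpos q hq
    rw [hζΦ q hq, sub_nonneg]
    rcases le_or_gt 0 (q 1) with hq1 | hq1
    · rw [(hηmono q hq hq1).1, hΦ0]
      constructor
      · rintro ⟨h0, h1⟩; exact ⟨mul_nonpos_of_nonneg_of_nonpos ha.le h0, h1⟩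
      · rintro ⟨h0, h1⟩
        refine ⟨?_, h1⟩
        by_contra h; push Not at h
        have := mul_pos ha h
        linarith
    · constructor
      · rintro ⟨-, h1⟩
        have hζ0 : 0 ≤ ρ q 1 := by rw [hζΦ q hq]; exact sub_nonneg.mpr h1
        obtain ⟨hq0, -⟩ := hηest q hq hq1 hζ0
        refine ⟨?_, h1⟩
        rw [hΦ0]
        exact (mul_neg_of_pos_of_neg ha hq0).le
      · rintro ⟨-, h1⟩
        have hζ0 : 0 ≤ ρ q 1 := by rw [hζΦ q hq]; exact sub_nonneg.mpr h1
        exact ⟨(hηest q hq hq1 hζ0).2.le, h1⟩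
  · -- the interior of `S j`
    obtain ⟨ha, -⟩ := hpos q hq
    rw [hζΦ q hq, sub_pos]
    rcases le_or_gt 0 (q 1) with hq1 | hq1
    · rw [(hηmono q hq hq1).2, hΦ0]
      constructor
      · rintro ⟨h0, h1⟩; exact ⟨mul_neg_of_pos_of_neg ha h0, h1⟩
      · rintro ⟨h0, h1⟩
        refine ⟨?_, h1⟩
        by_contra h; push Not at h
        have := mul_nonneg ha.le h
        linarith
    · constructor
      · rintro ⟨-, h1⟩
        have hζ0 : 0 ≤ ρ q 1 := by rw [hζΦ q hq]; exact (sub_pos.mpr h1).le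
        obtain ⟨hq0, -⟩ := hηest q hq hq1 hζ0
        refine ⟨?_, h1⟩
        rw [hΦ0]
        exact mul_neg_of_pos_of_neg ha hq0
      · rintro ⟨-, h1⟩
        have hζ0 : 0 ≤ ρ q 1 := by rw [hζΦ q hq]; exact (sub_pos.mpr h1).le
        exact ⟨(hηest q hq hq1 hζ0).2, h1⟩

end Straighten



section PrescribedPackage

variable {X : Type u} [TopologicalSpace X] [T2Space X] [ChartedSpace (EuclideanSpace ℝ (Fin 4)) X]
  {g : ℕ} {k : Fin 3 → ℕ} {S : Fin 3 → Set X}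

/-- **Linear charts of two adjacent sectors and the first-order structure of the third face,
with the neighbour `S j` prescribed** (variant of
`IsGKTrisection.exists_linearCharts_thirdFace`, whose `j` is chosen by the faces theorem; here
any `j ≠ i` is allowed, via `IsGKTrisection.exists_linearChart_face`).  For a Gay–Kirby
trisection, a sector `S i`, a sector `S j ≠ S i` and `x ∈ F`, there are linear charts
`c = A⁻¹ψ` of `S i` and `c' = A'⁻¹ψ'` of `S j`
on a common open neighbourhood `O` of `x` (`ψ x = ψ' x = 0`), normalised so that
`S i = {c ∈ Q}`, `S j = {c' ∈ Q}`, `F = ` stratum of both, the common face `S i ∩ S j` is the face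
`{q₀ = 0 ≤ q₁}` of both charts and the other faces lie in the third sector `S l`; the transition
`σ = c ∘ c'⁻¹` is `C^∞` at `c' y` for every `y ∈ O`; and at the `c'`-coordinates of every point
`y ∈ F ∩ O` its derivative `L` is injective, preserves the stratum plane, has
`(L e₁)₀ = 0 < (L e₁)₁`, and **`(L e₀)₀ < 0`, `(L e₀)₁ < 0`**: the third face
`S j ∩ S l = c'⁻¹{z₁ = 0 ≤ z₀}` leaves the central surface into the open third quadrant of the
normal plane of the chart of `S i` (first component by `firstOrder_of_linearCharts` for the pair
`(i, j)`; second component by the same for `(i, l)` in the chart of `S i` with swapped normal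
coordinates, transported along the chain rule `σ = (c ∘ c_l⁻¹) ∘ (c_l ∘ c'⁻¹)`,
`normal_apply_neg_of_comp`). [cite: GayKirby2016, Def. 1 and Fig. 1] [cite: Douady1961, §1] -/
theorem IsGKTrisection.exists_linearCharts_thirdFace_of_ne (h : IsGKTrisection X g k S)
    {i j : Fin 3} (hji : j ≠ i) {x : X} (hx : x ∈ ⋂ l, S l) :
    ∃ (ψ ψ' : OpenPartialHomeomorph X (EuclideanSpace ℝ (Fin 4)))
      (A A' : EuclideanSpace ℝ (Fin 4) ≃L[ℝ] EuclideanSpace ℝ (Fin 4)) (O : Set X) (l : Fin 3),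
      ψ ∈ IsManifold.maximalAtlas (𝓡 4) ∞ X ∧ ψ' ∈ IsManifold.maximalAtlas (𝓡 4) ∞ X ∧
      IsOpen O ∧ x ∈ O ∧ O ⊆ ψ.source ∧ O ⊆ ψ'.source ∧ ψ x = 0 ∧ ψ' x = 0 ∧
      l ≠ i ∧ l ≠ j ∧
      -- the chart of `S i`
      (∀ y ∈ O, y ∈ S i ↔ A.symm (ψ y) ∈ cornerQuadrant) ∧
      (∀ y ∈ O, y ∈ (⋂ m, S m) ↔
        A.symm (ψ y) ∈ cornerQuadrant ∧ A.symm (ψ y) 0 = 0 ∧ A.symm (ψ y) 1 = 0) ∧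
      (∀ y ∈ O, (∃ m, m ≠ i ∧ y ∈ S m) ↔ ¬ (0 < A.symm (ψ y) 0 ∧ 0 < A.symm (ψ y) 1)) ∧
      (∀ y ∈ O, A.symm (ψ y) 0 = 0 → 0 < A.symm (ψ y) 1 → y ∈ S j) ∧
      (∀ y ∈ O, A.symm (ψ y) 1 = 0 → 0 < A.symm (ψ y) 0 → y ∈ S l) ∧
      -- the chart of `S j`
      (∀ y ∈ O, y ∈ S j ↔ A'.symm (ψ' y) ∈ cornerQuadrant) ∧
      (∀ y ∈ O, y ∈ (⋂ m, S m) ↔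
        A'.symm (ψ' y) ∈ cornerQuadrant ∧ A'.symm (ψ' y) 0 = 0 ∧ A'.symm (ψ' y) 1 = 0) ∧
      (∀ y ∈ O, (∃ m, m ≠ j ∧ y ∈ S m) ↔ ¬ (0 < A'.symm (ψ' y) 0 ∧ 0 < A'.symm (ψ' y) 1)) ∧
      (∀ y ∈ O, A'.symm (ψ' y) 0 = 0 → 0 < A'.symm (ψ' y) 1 → y ∈ S i) ∧
      (∀ y ∈ O, A'.symm (ψ' y) 1 = 0 → 0 < A'.symm (ψ' y) 0 → y ∈ S l) ∧
      -- the transition `σ = c ∘ c'⁻¹`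
      (∀ y ∈ O, ContDiffAt ℝ ∞ (fun z => A.symm (ψ (ψ'.symm (A' z)))) (A'.symm (ψ' y))) ∧
      (∀ y ∈ O, y ∈ (⋂ m, S m) →
        Injective (fderiv ℝ (fun z => A.symm (ψ (ψ'.symm (A' z)))) (A'.symm (ψ' y))) ∧
        (∀ w : EuclideanSpace ℝ (Fin 4), w 0 = 0 → w 1 = 0 →
          fderiv ℝ (fun z => A.symm (ψ (ψ'.symm (A' z)))) (A'.symm (ψ' y)) w 0 = 0 ∧
          fderiv ℝ (fun z => A.symm (ψ (ψ'.symm (A' z)))) (A'.symm (ψ' y)) w 1 = 0) ∧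
        fderiv ℝ (fun z => A.symm (ψ (ψ'.symm (A' z)))) (A'.symm (ψ' y))
          (EuclideanSpace.single 1 1) 0 = 0 ∧
        0 < fderiv ℝ (fun z => A.symm (ψ (ψ'.symm (A' z)))) (A'.symm (ψ' y))
          (EuclideanSpace.single 1 1) 1 ∧
        fderiv ℝ (fun z => A.symm (ψ (ψ'.symm (A' z)))) (A'.symm (ψ' y))
          (EuclideanSpace.single 0 1) 0 < 0 ∧
        fderiv ℝ (fun z => A.symm (ψ (ψ'.symm (A' z)))) (A'.symm (ψ' y))
          (EuclideanSpace.single 0 1) 1 < 0) := by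
  -- the chart of `S i`, with the prescribed neighbour `S j` across the first face
  obtain ⟨ψ, A, O₁, l, hψ, hO₁, hxO₁, hO₁ψ, hψ0, hSi, hFi, hOi, hli, hlj', hfi0, hfi1⟩ :=
    h.exists_linearChart_face hji hx
  have hjl : j ≠ l := fun h' => hlj' h'.symm
  -- Fin 3 bookkeeping
  have third : ∀ m : Fin 3, m ≠ i → m ≠ j → m = l := by
    intro m hmi hmj
    have hcases : ∀ i j l m : Fin 3, j = i ∨ l = i ∨ l = j ∨ m = i ∨ m = j ∨ m = l := by decide
    rcases hcases i j l m with h' | h' | h' | h' | h' | h'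
    exacts [absurd h' hji, absurd h' hli, absurd h' hjl.symm, absurd h' hmi, absurd h' hmj, h']
  have third' : ∀ m : Fin 3, m ≠ i → m ≠ l → m = j := by
    intro m hmi hml
    have hcases : ∀ i j l m : Fin 3, j = i ∨ l = i ∨ l = j ∨ m = i ∨ m = l ∨ m = j := by decide
    rcases hcases i j l m with h' | h' | h' | h' | h' | h'
    exacts [absurd h' hji, absurd h' hli, absurd h' hjl.symm, absurd h' hmi, absurd h' hml, h']
  -- the chart of `S j`, with the common face `{z₀ = 0 ≤ z₁}` in `S i`
  obtain ⟨ψ', A', O₂, l', hψ', hO₂, hxO₂, hO₂ψ', hψ'0, hSj, hFj, hOj, hl'j, hl'i, hfj0, hfj1⟩ :=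
    h.exists_linearChart_face (i := j) (j := i) hji.symm hx
  obtain rfl : l = l' := (third l' hl'i hl'j).symm
  -- the chart of `S l`, with the face `{z₀ = 0 ≤ z₁}` in `S i`
  obtain ⟨ψ'', A'', O₃, j', hψ'', hO₃, hxO₃, hO₃ψ'', -, hSl, hFl, hOl, hj'l, hj'i, hfl0, hfl1⟩ :=
    h.exists_linearChart_face (i := l) (j := i) hli.symm hx
  obtain rfl : j = j' := (third' j' hj'i hj'l).symm
  -- the common neighbourhood
  set O := O₁ ∩ O₂ ∩ O₃ with hOdef
  have hO : IsOpen O := (hO₁.inter hO₂).inter hO₃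
  have hxO : x ∈ O := ⟨⟨hxO₁, hxO₂⟩, hxO₃⟩
  have h1 : O ⊆ O₁ := fun y hy => hy.1.1
  have h2 : O ⊆ O₂ := fun y hy => hy.1.2
  have h3 : O ⊆ O₃ := fun y hy => hy.2
  -- the swapped chart of `S i` (common face with `S l` first)
  obtain ⟨hSi', hFi', hOi', hfi0', hfi1'⟩ := linearChart_clauses_swap hSi hFi hOi hfi0 hfi1
  set A₂ := (LinearIsometryEquiv.piLpCongrLeft 2 ℝ ℝ
      (Equiv.swap (0 : Fin 4) 1)).toContinuousLinearEquiv.trans A with hA₂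
  refine ⟨ψ, ψ', A, A', O, l, hψ, hψ', hO, hxO, h1.trans hO₁ψ, h2.trans hO₂ψ', hψ0, hψ'0,
    hli, hjl.symm,
    fun y hy => hSi y (h1 hy), fun y hy => hFi y (h1 hy), fun y hy => hOi y (h1 hy),
    fun y hy => hfi0 y (h1 hy), fun y hy => hfi1 y (h1 hy),
    fun y hy => hSj y (h2 hy), fun y hy => hFj y (h2 hy), fun y hy => hOj y (h2 hy),
    fun y hy => hfj0 y (h2 hy), fun y hy => hfj1 y (h2 hy),
    fun y hy => contDiffAt_transition hψ hψ' (hO₁ψ (h1 hy)) (hO₂ψ' (h2 hy)),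
    fun y hy hyF => ?_⟩
  -- first order for the pair `(i, j)`
  obtain ⟨hstr', he1_0, he1_1, hν0⟩ := firstOrder_of_linearCharts (S := S) hji hli hjl.symm hψ hψ'
    hO (h1.trans hO₁ψ) (h2.trans hO₂ψ')
    (fun y hy => hSi y (h1 hy)) (fun y hy => hFi y (h1 hy)) (fun y hy => hOi y (h1 hy))
    (fun y hy => hfi1 y (h1 hy))
    (fun y hy => hSj y (h2 hy)) (fun y hy => hFj y (h2 hy)) (fun y hy => hOj y (h2 hy))
    (fun y hy => hfj0 y (h2 hy)) hy hyF
  -- first order for the pair `(i, l)`, in the swapped chart of `S i`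
  obtain ⟨hstr'', -, -, hμ0⟩ := firstOrder_of_linearCharts (S := S) (A := A₂) hli hji hjl hψ hψ''
    hO (h1.trans hO₁ψ) (h3.trans hO₃ψ'')
    (fun y hy => hSi' y (h1 hy)) (fun y hy => hFi' y (h1 hy)) (fun y hy => hOi' y (h1 hy))
    (fun y hy => hfi1' y (h1 hy))
    (fun y hy => hSl y (h3 hy)) (fun y hy => hFl y (h3 hy)) (fun y hy => hOl y (h3 hy))
    (fun y hy => hfl0 y (h3 hy)) hy hyF
  -- the transitions
  set σ' : EuclideanSpace ℝ (Fin 4) → EuclideanSpace ℝ (Fin 4) :=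
    fun z => A.symm (ψ (ψ'.symm (A' z))) with hσ'
  set σ'' : EuclideanSpace ℝ (Fin 4) → EuclideanSpace ℝ (Fin 4) :=
    fun z => A.symm (ψ (ψ''.symm (A'' z))) with hσ''
  set σ₂ : EuclideanSpace ℝ (Fin 4) → EuclideanSpace ℝ (Fin 4) :=
    fun z => A₂.symm (ψ (ψ''.symm (A'' z))) with hσ₂
  set τ : EuclideanSpace ℝ (Fin 4) → EuclideanSpace ℝ (Fin 4) :=
    fun z => A''.symm (ψ'' (ψ'.symm (A' z))) with hτ
  set p := A'.symm (ψ' y) with hp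
  set p'' := A''.symm (ψ'' y) with hp''
  -- `σ₂ = E ∘ σ''` with `E` the coordinate swap read through `A`
  set E : EuclideanSpace ℝ (Fin 4) ≃L[ℝ] EuclideanSpace ℝ (Fin 4) := A.trans A₂.symm with hE
  have hEapply : ∀ (w : EuclideanSpace ℝ (Fin 4)) (k : Fin 4),
      E w k = w (Equiv.swap (0 : Fin 4) 1 k) := by
    intro w k
    rw [hE, ContinuousLinearEquiv.trans_apply, hA₂, swap_trans_symm_apply,
      ContinuousLinearEquiv.symm_apply_apply]
  have hσ₂E : σ₂ = E ∘ σ'' := by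
    funext z
    simp only [hσ₂, hσ'', comp_apply, hE, ContinuousLinearEquiv.trans_apply,
      ContinuousLinearEquiv.apply_symm_apply]
  have hfd₂ : ∀ v (k : Fin 4),
      fderiv ℝ σ₂ p'' v k = fderiv ℝ σ'' p'' v (Equiv.swap (0 : Fin 4) 1 k) := by
    intro v k
    rw [hσ₂E, E.comp_fderiv, ContinuousLinearMap.comp_apply]
    exact hEapply _ _
  -- stratum invariance and `(L'' e₀)₁ < 0` for `σ''`
  have hstrL'' : ∀ w : EuclideanSpace ℝ (Fin 4), w 0 = 0 → w 1 = 0 →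
      fderiv ℝ σ'' p'' w 0 = 0 ∧ fderiv ℝ σ'' p'' w 1 = 0 := by
    intro w hw0 hw1
    obtain ⟨h0, h1'⟩ := hstr'' w hw0 hw1
    rw [hfd₂] at h0 h1'
    simp only [Equiv.swap_apply_left, Equiv.swap_apply_right] at h0 h1'
    exact ⟨h1', h0⟩
  have hν''1 : fderiv ℝ σ'' p'' (EuclideanSpace.single 0 1) 1 < 0 := by
    rw [hfd₂] at hμ0
    simpa only [Equiv.swap_apply_left] using hμ0
  -- derivatives of `σ'`, `σ''`, `τ`
  have hyψ : y ∈ ψ.source := hO₁ψ (h1 hy)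
  have hyψ' : y ∈ ψ'.source := hO₂ψ' (h2 hy)
  have hyψ'' : y ∈ ψ''.source := hO₃ψ'' (h3 hy)
  have hdσ' : HasFDerivAt σ' (fderiv ℝ σ' p) p :=
    ((contDiffAt_transition hψ hψ' hyψ hyψ').differentiableAt (by simp)).hasFDerivAt
  have hdτ : HasFDerivAt τ (fderiv ℝ τ p) p :=
    ((contDiffAt_transition hψ'' hψ' hyψ'' hyψ').differentiableAt (by simp)).hasFDerivAt
  have hτp : τ p = p'' := transition_apply_chart hyψ'
  have hdσ'' : HasFDerivAt σ'' (fderiv ℝ σ'' p'') (τ p) := by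
    rw [hτp]
    exact ((contDiffAt_transition hψ hψ'' hyψ hyψ'').differentiableAt (by simp)).hasFDerivAt
  -- the chain rule `σ' = σ'' ∘ τ` near `p`
  have hev := eventually_transition (A' := A') hyψ' (hO.mem_nhds hy)
  have hcomp : σ' =ᶠ[𝓝 p] σ'' ∘ τ := by
    filter_upwards [hev] with z hz
    obtain ⟨hzO, -⟩ := hz
    simp only [hσ', hσ'', hτ, comp_apply, ContinuousLinearEquiv.apply_symm_apply,
      ψ''.left_inv (hO₃ψ'' (h3 hzO))]
  -- `p` and `τ p` are stratum points
  have hpstr : p 0 = 0 ∧ p 1 = 0 := ((hFj y (h2 hy)).1 hyF).2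
  have hτpstr : τ p 0 = 0 ∧ τ p 1 = 0 := by
    rw [hτp]
    exact ((hFl y (h3 hy)).1 hyF).2
  -- `τ` maps the third face `{z₁ = 0 ≤ z₀}` into `{z₁ = 0 ≤ z₀}`
  have hT : ∀ᶠ z in 𝓝 p, (z 1 = 0 ∧ 0 ≤ z 0) → (τ z 1 = 0 ∧ 0 ≤ τ z 0) := by
    filter_upwards [hev] with z hz hz10
    obtain ⟨hzO, hzc⟩ := hz
    set y' := ψ'.symm (A' z) with hy'
    have hτz : τ z = A''.symm (ψ'' y') := rfl
    rcases hz10.2.lt_or_eq with h0 | h0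
    · -- a point of the open third face: in `S j` and `S l`
      have hyj : y' ∈ S j := (hSj y' (h2 hzO)).2 (by rw [hzc]; exact ⟨hz10.2, le_of_eq hz10.1.symm⟩)
      have hyl : y' ∈ S l := hfj1 y' (h2 hzO) (by rw [hzc]; exact hz10.1) (by rwa [hzc])
      have hQ : A''.symm (ψ'' y') ∈ cornerQuadrant := (hSl y' (h3 hzO)).1 hyl
      have hnot : ¬ (0 < A''.symm (ψ'' y') 0 ∧ 0 < A''.symm (ψ'' y') 1) :=
        (hOl y' (h3 hzO)).1 ⟨j, hjl, hyj⟩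
      rw [hτz]
      refine ⟨?_, hQ.1⟩
      rcases hQ.2.lt_or_eq with h1' | h1'
      · exfalso
        have hc0 : A''.symm (ψ'' y') 0 = 0 := by
          rcases hQ.1.lt_or_eq with h0' | h0'
          · exact absurd ⟨h0', h1'⟩ hnot
          · exact h0'.symm
        have hyi : y' ∈ S i := hfl0 y' (h3 hzO) hc0 h1'
        have hyF : y' ∈ ⋂ m, S m := mem_iInter_of_mem_three hji hli hjl.symm hyi hyj hyl
        have := ((hFl y' (h3 hzO)).1 hyF).2.2
        rw [this] at h1'
        exact lt_irrefl _ h1'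
      · exact h1'.symm
    · -- a point of the stratum
      have hyF : y' ∈ ⋂ m, S m := by
        refine (hFj _ (h2 hzO)).2 ?_
        rw [hzc]
        exact ⟨⟨hz10.2, le_of_eq hz10.1.symm⟩, h0.symm, hz10.1⟩
      rw [hτz]
      obtain ⟨-, h0', h1'⟩ := (hFl _ (h3 hzO)).1 hyF
      exact ⟨h1', le_of_eq h0'.symm⟩
  have hν1 := (normal_apply_neg_of_comp hdτ hdσ'' hdσ' hcomp hpstr hτpstr hT hstrL'' hν0
    hν''1).2
  exact ⟨injective_fderiv_transition hψ hψ' hyψ hyψ', hstr', he1_0, he1_1, hν0, hν1⟩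

end PrescribedPackage

/-! ### `C^∞` groupoid bookkeeping for the model `𝓡 4` -/

section Groupoid

variable {X : Type u} [TopologicalSpace X] [ChartedSpace (EuclideanSpace ℝ (Fin 4)) X]

/-- An open partial homeomorphism of `ℝ⁴` which is `C^∞` on its source with `C^∞` inverse on
its target belongs to the `C^∞` groupoid of the model `𝓡 4`. [folklore] -/
theorem contDiffGroupoid_mem_of_contDiffOn_symm
    {G : OpenPartialHomeomorph (EuclideanSpace ℝ (Fin 4)) (EuclideanSpace ℝ (Fin 4))}
    (h₁ : ContDiffOn ℝ ∞ G G.source) (h₂ : ContDiffOn ℝ ∞ G.symm G.target) :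
    G ∈ contDiffGroupoid ∞ (𝓡 4) := by
  rw [contDiffGroupoid, mem_groupoid_of_pregroupoid]
  simp only [contDiffPregroupoid, modelWithCornersSelf_coe, modelWithCornersSelf_coe_symm,
    CompTriple.comp_eq, preimage_id_eq, id_eq, range_id, inter_univ]
  exact ⟨h₁, h₂⟩

/-- Post-composing a chart of the maximal `C^∞` atlas with an element of the `C^∞` groupoid of
the model gives a chart of the maximal atlas. [folklore] -/
theorem trans_mem_maximalAtlas [IsManifold (𝓡 4) ∞ X]
    {e : OpenPartialHomeomorph X (EuclideanSpace ℝ (Fin 4))}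
    (he : e ∈ IsManifold.maximalAtlas (𝓡 4) ∞ X)
    {G : OpenPartialHomeomorph (EuclideanSpace ℝ (Fin 4)) (EuclideanSpace ℝ (Fin 4))}
    (hG : G ∈ contDiffGroupoid ∞ (𝓡 4)) :
    e.trans G ∈ IsManifold.maximalAtlas (𝓡 4) ∞ X := by
  rw [IsManifold.maximalAtlas, mem_maximalAtlas_iff]
  intro e' he'
  have he'max : e' ∈ IsManifold.maximalAtlas (𝓡 4) ∞ X := IsManifold.subset_maximalAtlas he'
  constructor
  · rw [OpenPartialHomeomorph.trans_symm_eq_symm_trans_symm, OpenPartialHomeomorph.trans_assoc]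
    exact (contDiffGroupoid ∞ (𝓡 4)).trans ((contDiffGroupoid ∞ (𝓡 4)).symm hG)
      (StructureGroupoid.compatible_of_mem_maximalAtlas he he'max)
  · rw [← OpenPartialHomeomorph.trans_assoc]
    exact (contDiffGroupoid ∞ (𝓡 4)).trans
      (StructureGroupoid.compatible_of_mem_maximalAtlas he'max he) hG

end Groupoid

/-! ### The joint linearising chart -/

section JointChart

variable {X : Type u} [TopologicalSpace X] [T2Space X] [ChartedSpace (EuclideanSpace ℝ (Fin 4)) X]
  [IsManifold (𝓡 4) ∞ X] {g : ℕ} {k : Fin 3 → ℕ} {S : Fin 3 → Set X}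

/-- **The joint linearising chart of a Gay–Kirby trisection at a point of the central surface
(Gay–Kirby's Fig. 1 over the predicate).**  For a trisection with corners `S` of the smooth
`4`-manifold `X` (`IsGKTrisection`), a sector `S i`, a second sector `S j` and a point `x` of
the central surface `F = ⋂ l, S l`, there is a chart `Θ` of the maximal `C^∞` atlas of `X`
at `x` (`Θ x = 0`) in
which, writing `(q₀, q₁)` for the first two coordinates, **all three sectors are linear
sectors of the normal plane**:
`S i = {q₀ ≥ 0, q₁ ≥ 0}` (angle `π/2`), `S j = {q₀ ≤ 0, q₀ ≤ q₁}` and `S l = {q₁ ≤ 0, q₁ ≤ q₀}`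
(angle `3π/4` each, separated by the diagonal ray `{q₀ = q₁ ≤ 0}`), and `F = {q₀ = q₁ = 0}`.
It is obtained from the linear chart of `S i` (`IsGKTrisection.exists_linearCharts_thirdFace`)
by the local diffeomorphism of `exists_straighten_thirdFace`, which straightens the third face
`S j ∩ S l` while preserving the quadrant. [cite: GayKirby2016, Def. 1 and Fig. 1]
[cite: Douady1961, §1 and §4] -/
theorem IsGKTrisection.exists_jointChart (h : IsGKTrisection X g k S) {i j : Fin 3}
    (hji : j ≠ i) {x : X} (hx : x ∈ ⋂ l, S l) :
    ∃ (Θ : OpenPartialHomeomorph X (EuclideanSpace ℝ (Fin 4))) (l : Fin 3),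
      Θ ∈ IsManifold.maximalAtlas (𝓡 4) ∞ X ∧ x ∈ Θ.source ∧ Θ x = 0 ∧
      l ≠ i ∧ l ≠ j ∧
      (∀ y ∈ Θ.source, y ∈ S i ↔ (0 ≤ Θ y 0 ∧ 0 ≤ Θ y 1)) ∧
      (∀ y ∈ Θ.source, y ∈ (⋂ m, S m) ↔ (Θ y 0 = 0 ∧ Θ y 1 = 0)) ∧
      (∀ y ∈ Θ.source, y ∈ S j ↔ (Θ y 0 ≤ 0 ∧ Θ y 0 ≤ Θ y 1)) ∧
      (∀ y ∈ Θ.source, y ∈ S l ↔ (Θ y 1 ≤ 0 ∧ Θ y 1 ≤ Θ y 0)) := by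
  obtain ⟨ψ, ψ', A, A', O, l, hψ, hψ', hO, hxO, hOψ, hOψ', hψ0, hψ'0, hli, hlj,
    hSi, hFi, hOi, hfi0, hfi1, hSj, hFj, hOj, hfj0, hfj1, hsmooth, hfirst⟩ :=
    h.exists_linearCharts_thirdFace_of_ne hji hx
  -- the coordinates `c = A⁻¹ ψ` and the inverse transition `ρ = c' ∘ c⁻¹`
  set c : X → EuclideanSpace ℝ (Fin 4) := fun y => A.symm (ψ y) with hc
  set ρ : EuclideanSpace ℝ (Fin 4) → EuclideanSpace ℝ (Fin 4) :=
    fun q => A'.symm (ψ' (ψ.symm (A q))) with hρ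
  have hcx : c x = 0 := by simp [hc, hψ0]
  have hρc : ∀ y ∈ O, ρ (c y) = A'.symm (ψ' y) := fun y hy => by
    simp [hρ, hc, ψ.left_inv (hOψ hy)]
  -- `c(O)` is an open neighbourhood of `0`; a ball inside it
  have hcO : IsOpen (c '' O) := by
    have : c '' O = A.symm '' (ψ '' O) := by rw [hc, ← image_comp]; rfl
    rw [this]
    exact A.symm.toHomeomorph.isOpenMap _ (ψ.isOpen_image_of_subset_source hO hOψ)
  obtain ⟨r, hr, hball⟩ := Metric.isOpen_iff.mp hcO 0 (hcx ▸ mem_image_of_mem c hxO)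
  have hcinj : ∀ y ∈ O, ∀ y' ∈ O, c y = c y' → y = y' := by
    intro y hy y' hy' hyy
    have : ψ y = ψ y' := A.symm.injective hyy
    exact ψ.injOn (hOψ hy) (hOψ hy') this
  have hpre : ∀ q ∈ Metric.ball (0 : EuclideanSpace ℝ (Fin 4)) r, ∃ y ∈ O, c y = q :=
    fun q hq => by obtain ⟨y, hy, hyq⟩ := hball hq; exact ⟨y, hy, hyq⟩
  -- hypotheses of `exists_straighten_thirdFace`
  have hρs : ContDiffOn ℝ ∞ ρ (Metric.ball 0 r) := by
    intro q hq
    obtain ⟨y, hy, rfl⟩ := hpre q hq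
    exact (contDiffAt_transition (A := A') (A' := A) hψ' hψ (hOψ' hy) (hOψ hy)).contDiffWithinAt
  have hstr : ∀ q ∈ Metric.ball (0 : EuclideanSpace ℝ (Fin 4)) r,
      q 0 = 0 → q 1 = 0 → ρ q 0 = 0 ∧ ρ q 1 = 0 := by
    intro q hq hq0 hq1
    obtain ⟨y, hy, rfl⟩ := hpre q hq
    have hyF : y ∈ ⋂ m, S m := (hFi y hy).2 ⟨⟨le_of_eq hq0.symm, le_of_eq hq1.symm⟩, hq0, hq1⟩
    rw [hρc y hy]
    exact ((hFj y hy).1 hyF).2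
  have hface : ∀ q ∈ Metric.ball (0 : EuclideanSpace ℝ (Fin 4)) r,
      q 0 = 0 → 0 ≤ q 1 → ρ q 0 = 0 := by
    intro q hq hq0 hq1
    obtain ⟨y, hy, rfl⟩ := hpre q hq
    rw [hρc y hy]
    rcases hq1.lt_or_eq with h1 | h1
    · have hyi : y ∈ S i := (hSi y hy).2 ⟨le_of_eq hq0.symm, hq1⟩
      have hyj : y ∈ S j := hfi0 y hy hq0 h1
      have hQ' : A'.symm (ψ' y) ∈ cornerQuadrant := (hSj y hy).1 hyj
      have hnot : ¬ (0 < A'.symm (ψ' y) 0 ∧ 0 < A'.symm (ψ' y) 1) := (hOj y hy).1 ⟨i, hji.symm, hyi⟩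
      rcases hQ'.1.lt_or_eq with h0 | h0
      · exfalso
        have hc1 : A'.symm (ψ' y) 1 = 0 := by
          rcases hQ'.2.lt_or_eq with h1' | h1'
          · exact absurd ⟨h0, h1'⟩ hnot
          · exact h1'.symm
        have hyl : y ∈ S l := hfj1 y hy hc1 h0
        have hyF : y ∈ ⋂ m, S m := mem_iInter_of_mem_three hji hli hlj hyi hyj hyl
        have := ((hFj y hy).1 hyF).2.1
        rw [this] at h0; exact lt_irrefl _ h0
      · exact h0.symm
    · have hyF : y ∈ ⋂ m, S m := (hFi y hy).2 ⟨⟨le_of_eq hq0.symm, hq1⟩, hq0, h1.symm⟩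
      exact ((hFj y hy).1 hyF).2.1
  -- first-order data of `ρ` at `0 = c x`
  obtain ⟨hLinj, hLstr, hL10, hL11, hν0, hν1⟩ := hfirst x hxO hx
  have hML := fderiv_transition_comp_eq_id (A := A) (A' := A') hψ hψ' (hOψ hxO) (hOψ' hxO)
  obtain ⟨-, hM10, hM11, hM00, hM01⟩ := firstOrder_inverse hML hLstr hL10 hL11 hν0 hν1
  have hfd0 : fderiv ℝ ρ 0 = fderiv ℝ (fun w => A'.symm (ψ' (ψ.symm (A w)))) (A.symm (ψ x)) := by
    rw [show (A.symm (ψ x)) = 0 from hcx]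
  rw [← hfd0] at hM10 hM11 hM00 hM01
  obtain ⟨Φ, hΦ0, hΦ00, hΦball, hΦs, hΦsymm, -, hsign, hζ, hSjΦ, hSjΦ'⟩ :=
    exists_straighten_thirdFace hr hρs hstr hface hM00 hM10 hM01 hM11
  -- ### the chart `Θ = Φ ∘ A⁻¹ ∘ ψ`
  set Aff : OpenPartialHomeomorph (EuclideanSpace ℝ (Fin 4)) (EuclideanSpace ℝ (Fin 4)) :=
    A.symm.toHomeomorph.toOpenPartialHomeomorph with hAff
  set G := Aff.trans Φ with hG
  set Θ := ψ.trans G with hΘ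
  have hΘapply : ∀ y, Θ y = Φ (c y) := fun y => rfl
  have hΘsrc : ∀ y, y ∈ Θ.source ↔ y ∈ ψ.source ∧ c y ∈ Φ.source := by
    intro y
    simp [hΘ, hG, hAff, hc]
  have hsrcO : ∀ y ∈ Θ.source, y ∈ O ∧ c y ∈ Φ.source := by
    intro y hy
    obtain ⟨hyψ, hcy⟩ := (hΘsrc y).1 hy
    obtain ⟨y', hy', hyy'⟩ := hpre _ (hΦball hcy)
    have : y' = y := by
      have : ψ y' = ψ y := A.symm.injective hyy'
      exact ψ.injOn (hOψ hy') hyψ this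
    subst this
    exact ⟨hy', hcy⟩
  -- `G` is in the `C^∞` groupoid, so `Θ` is in the maximal atlas
  have hGmem : G ∈ contDiffGroupoid ∞ (𝓡 4) := by
    refine contDiffGroupoid_mem_of_contDiffOn_symm ?_ ?_
    · -- `G = Φ ∘ A⁻¹` on `G.source = A (Φ.source)`-preimage
      intro q hq
      have hq' : A.symm q ∈ Φ.source := by
        simpa [hG, hAff, OpenPartialHomeomorph.trans_source] using hq
      have h1 : ContDiffWithinAt ℝ ∞ Φ Φ.source (A.symm q) := hΦs _ hq'
      have h2 : ContDiffAt ℝ ∞ Φ (A.symm q) := h1.contDiffAt (Φ.open_source.mem_nhds hq')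
      exact (h2.comp q A.symm.contDiff.contDiffAt).contDiffWithinAt
    · intro q hq
      have hq' : q ∈ Φ.target := by
        simpa [hG, hAff, OpenPartialHomeomorph.trans_target] using hq
      have h1 : ContDiffAt ℝ ∞ Φ.symm q :=
        (hΦsymm q hq').contDiffAt (Φ.open_target.mem_nhds hq')
      have : (G.symm : EuclideanSpace ℝ (Fin 4) → EuclideanSpace ℝ (Fin 4)) =
          fun q => A (Φ.symm q) := by
        funext q; simp [hG, hAff]
      rw [this]
      exact (A.contDiff.contDiffAt.comp q h1).contDiffWithinAt
  have hΘmem : Θ ∈ IsManifold.maximalAtlas (𝓡 4) ∞ X := trans_mem_maximalAtlas hψ hGmem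
  have hxΘ : x ∈ Θ.source := (hΘsrc x).2 ⟨hOψ hxO, by rw [hcx]; exact hΦ0⟩
  have hΘx : Θ x = 0 := by rw [hΘapply, hcx, hΦ00]
  refine ⟨Θ, l, hΘmem, hxΘ, hΘx, hli, hlj, fun y hy => ?_, fun y hy => ?_,
    fun y hy => ?_, fun y hy => ?_⟩
  · -- `S i`
    obtain ⟨hyO, hcy⟩ := hsrcO y hy
    obtain ⟨h0, -, h1, -⟩ := hsign _ hcy
    rw [hSi y hyO, hΘapply]
    show (0 ≤ c y 0 ∧ 0 ≤ c y 1) ↔ _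
    rw [h0, h1]
  · -- `F`
    obtain ⟨hyO, hcy⟩ := hsrcO y hy
    obtain ⟨h0, h0', h1, h1'⟩ := hsign _ hcy
    rw [hFi y hyO, hΘapply]
    show ((0 ≤ c y 0 ∧ 0 ≤ c y 1) ∧ c y 0 = 0 ∧ c y 1 = 0) ↔ _
    have e0 : c y 0 = 0 ↔ Φ (c y) 0 = 0 := by
      constructor
      · intro h; exact le_antisymm (not_lt.mp fun hp => (lt_irrefl _) (h ▸ h0'.mpr hp)) (h0.mp h.ge)
      · intro h; exact le_antisymm (not_lt.mp fun hp => (lt_irrefl _) (h ▸ h0'.mp hp)) (h0.mpr h.ge)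
    have e1 : c y 1 = 0 ↔ Φ (c y) 1 = 0 := by
      constructor
      · intro h; exact le_antisymm (not_lt.mp fun hp => (lt_irrefl _) (h ▸ h1'.mpr hp)) (h1.mp h.ge)
      · intro h; exact le_antisymm (not_lt.mp fun hp => (lt_irrefl _) (h ▸ h1'.mp hp)) (h1.mpr h.ge)
    rw [e0, e1]
    constructor
    · rintro ⟨-, ha, hb⟩; exact ⟨ha, hb⟩
    · rintro ⟨ha, hb⟩; exact ⟨⟨h0.mpr ha.ge, h1.mpr hb.ge⟩, ha, hb⟩
  · -- `S j`
    obtain ⟨hyO, hcy⟩ := hsrcO y hy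
    rw [hSj y hyO, hΘapply, ← hρc y hyO]
    exact hSjΦ _ hcy
  · -- `S l`
    obtain ⟨hyO, hcy⟩ := hsrcO y hy
    obtain ⟨h0, h0', h1, h1'⟩ := hsign _ hcy
    obtain ⟨hζ0, hζ1⟩ := hζ _ hcy
    rw [hΘapply]
    set U := Φ (c y) 0 with hU
    set V := Φ (c y) 1 with hV
    constructor
    · intro hyl
      -- not in the open sector of `S i`, of `S j`, nor on the open first face of `S i`
      have hni : ¬ (0 < U ∧ 0 < V) := by
        rw [hU, hV, ← h0', ← h1']
        exact (hOi y hyO).1 ⟨l, hli, hyl⟩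
      have hnj : ¬ (U < 0 ∧ U < V) := by
        rw [hU, hV, ← hSjΦ' _ hcy, hρc y hyO]
        exact (hOj y hyO).1 ⟨l, hlj, hyl⟩
      have hnf : ¬ (U = 0 ∧ 0 < V) := by
        rintro ⟨hU0, hV0⟩
        have hc0 : c y 0 = 0 := by
          refine le_antisymm (not_lt.mp fun hp => ?_) (h0.mpr (le_of_eq hU0.symm))
          have := h0'.mp hp
          rw [hU0] at this
          exact lt_irrefl _ this
        have hc1 : 0 < c y 1 := h1'.mpr hV0
        have hyi : y ∈ S i := (hSi y hyO).2 ⟨le_of_eq hc0.symm, hc1.le⟩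
        have hyj : y ∈ S j := hfi0 y hyO hc0 hc1
        have hyF : y ∈ ⋂ m, S m := mem_iInter_of_mem_three hji hli hlj hyi hyj hyl
        have := ((hFi y hyO).1 hyF).2.2
        rw [this] at hc1; exact lt_irrefl _ hc1
      constructor
      · by_contra hVpos; push Not at hVpos
        have hUle : U ≤ 0 := by
          by_contra hUpos; push Not at hUpos
          exact hni ⟨hUpos, hVpos⟩
        rcases hUle.lt_or_eq with hUneg | hU0
        · exact hnj ⟨hUneg, hUneg.trans hVpos⟩
        · exact hnf ⟨hU0, hVpos⟩
      · by_contra hVU; push Not at hVU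
        -- then `U < V`; with `V ≤ 0`? we only know `¬(0 < U ∧ 0 < V)` etc.
        have hV0 : V ≤ 0 := by
          by_contra hVpos; push Not at hVpos
          have hUle : U ≤ 0 := by
            by_contra hUpos; push Not at hUpos
            exact hni ⟨hUpos, hVpos⟩
          rcases hUle.lt_or_eq with hUneg | hU0
          · exact hnj ⟨hUneg, hUneg.trans hVpos⟩
          · exact hnf ⟨hU0, hVpos⟩
        have hUneg : U < 0 := lt_of_lt_of_le hVU hV0
        exact hnj ⟨hUneg, hVU⟩
    · rintro ⟨hV0, hVU⟩
      by_cases hyi : y ∈ S i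
      · -- on the closed second face of `S i`
        have hQ : c y ∈ cornerQuadrant := (hSi y hyO).1 hyi
        have hc1 : c y 1 = 0 := le_antisymm (by
          by_contra hp; push Not at hp
          exact (lt_irrefl (0:ℝ)) (lt_of_lt_of_le (h1'.mp hp) hV0)) hQ.2
        rcases hQ.1.lt_or_eq with hc0 | hc0
        · exact hfi1 y hyO hc1 hc0
        · have hyF : y ∈ ⋂ m, S m := (hFi y hyO).2 ⟨hQ, hc0.symm, hc1⟩
          exact mem_iInter.mp hyF l
      · by_cases hyj : y ∈ S j
        · -- on the third face
          have hQ' : A'.symm (ψ' y) ∈ cornerQuadrant := (hSj y hyO).1 hyj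
          obtain ⟨hUle, hUV⟩ := (hSjΦ _ hcy).1 (by rw [hρc y hyO]; exact ⟨hQ'.1, hQ'.2⟩)
          have hUV' : U = V := le_antisymm hUV hVU
          have hζzero : A'.symm (ψ' y) 1 = 0 := by
            have hnp : ¬ (0 < ρ (c y) 1) := fun hp => by
              have := hζ1.mp hp
              rw [hUV'] at this
              exact lt_irrefl _ this
            rw [hρc y hyO] at hnp
            exact le_antisymm (not_lt.mp hnp) hQ'.2
          rcases hQ'.1.lt_or_eq with hc0 | hc0
          · exact hfj1 y hyO hζzero hc0
          · have hyF : y ∈ ⋂ m, S m := (hFj y hyO).2 ⟨hQ', hc0.symm, hζzero⟩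
            exact mem_iInter.mp hyF l
        · -- in neither `S i` nor `S j`: in `S l` by the covering clause
          obtain ⟨m, hm⟩ := h.exists_mem y
          have hcases : ∀ i j l m : Fin 3, j = i ∨ l = i ∨ l = j ∨ m = i ∨ m = j ∨ m = l := by
            decide
          rcases hcases i j l m with h' | h' | h' | rfl | rfl | rfl
          · exact absurd h' hji
          · exact absurd h' hli
          · exact absurd h' hlj
          · exact absurd hm hyi
          · exact absurd hm hyj
          · exact hm

end JointChart

end Literature.Topology.FourManifolds
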